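import Summits.HubbardSuperconductivity.HubbardSuperconductivity.Theorems.DeformationLadderLowEnergyRigidityTelescopePoincare

/-!
# Route `DeformationLadder`, crux `LowEnergyRigidity` (item `stmt-HubbardSuperconductivity-1892`):
# the Poincaré telescope — the dyadic chain `4 → 8 → 16 → ⋯` at a fixed side

Support file (`--supports stmt-HubbardSuperconductivity-1892`) for the line `Sketch` (poincare-telescope
spine), stub `stub_chain`, over the vocabulary of `DeformationLadderLowEnergyRigidityTelescopeDefs`
(`cellCoherence`, `cellDirichlet`) and the refinement inequality `re_expect_cellCoherence_ge` of
`DeformationLadderLowEnergyRigidityTelescopePoincare` (`4 Re⟨𝒞_{2k}⟩ − 2 Re⟨𝒟_{2k}⟩ ≤ Re⟨𝒞_k⟩`).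

Write `c_k = Re⟨φ, 𝒞_k φ⟩`, `d_k = Re⟨φ, 𝒟_k φ⟩` and `ρ_k = (k²/L⁴) c_k` (the average cell coherence
density at cell count `k`). Main result `stub_chain`: at a fixed side `L` and vector `φ`, under the
scale-wise Josephson hypothesis at `φ` (rate `J > 0`, slack constant `C ≥ 0`, bottom scale `ℓ₁`,
energy budget `E ≥ 0`: `J (k/L)⁴ d_k − C J k³/L ≤ E` for `4 ≤ k`, `k ℓ₁ ≤ L`),
`ρ_{4·2^m} ≤ ρ_4 + E/(96 J) + C·(4·2^m)/L` whenever `4·2^m·ℓ₁ ≤ L`.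

Ingredients (real arithmetic only, on top of the landed refinement inequality):
* `step_arith`, `density_step` — ONE dyadic step in density units: the refinement inequality gives
  `ρ_{2k} ≤ ρ_k + ((2k)²/(2L⁴)) d_{2k}`, and Josephson at `2k` bounds
  `((2k)²/(2L⁴)) d_{2k} ≤ E/(8 J k²) + C k/L`;
* `chain_step_arith`, `chain_aux` — induction on `m` with the sharp invariant
  `ρ_{4·2^m} ≤ ρ_4 + (E/(96J))(1 − 4^{-m}) + C (4·2^m − 4)/L`
  (`Σ_{j<m} E/(8 J (4·2^j)²) = (E/(96 J))(1 − 4^{-m})`, `Σ_{j<m} 4·2^j = 4·2^m − 4`);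
* `chain_final_arith` — dropping the nonpositive corrections (`E, C ≥ 0`, `J, L > 0`);
* `cellCoherence_congr` — transport of `𝒞_k` along equal cell counts (the `NeZero` instance is a
  proposition), used to identify `𝒞_{4·2^0}` with `𝒞_4`.
All elementary [folklore]; source of the construction: the idea card poincare-telescope (2026-08-16).
-/

noncomputable section

namespace Summit.HubbardSuperconductivity.HubbardSuperconductivity.Theorems.LowEnergyRigidity.Telescope

set_option linter.dupNamespace false -- summit = problem name (single-conjunct summit), D-0017

open Matrix
open scoped ComplexOrder
open Literature.MathematicalPhysics.QuantumLattice Literature.Probability.LatticeModels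

/-! ### Real arithmetic of the chain -/

/-- One dyadic step in density units, over plain reals: from the refinement inequality
`4 c_{2k} − 2 d_{2k} ≤ c_k` and Josephson at `2k`, `J (2k/L)⁴ d_{2k} − C J (2k)³/L ≤ E`, deduce
`((2k)²/L⁴) c_{2k} ≤ (k²/L⁴) c_k + E/(8 J k²) + C k/L`. [folklore] -/
theorem step_arith {cK c2 d2 k L J C E : ℝ} (hk : 0 < k) (hJ : 0 < J)
    (href : 4 * c2 - 2 * d2 ≤ cK)
    (hjos : J * (2 * k / L) ^ 4 * d2 - C * J * (2 * k) ^ 3 / L ≤ E) :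
    (2 * k) ^ 2 / L ^ 4 * c2 ≤ k ^ 2 / L ^ 4 * cK + E / (8 * J * k ^ 2) + C * k / L := by
  -- Josephson at `2k` in density units
  have hjos' : 16 * J * k ^ 4 * (d2 / L ^ 4) - 8 * (C * J * k ^ 3 / L) ≤ E := by
    have e : J * (2 * k / L) ^ 4 * d2 - C * J * (2 * k) ^ 3 / L =
        16 * J * k ^ 4 * (d2 / L ^ 4) - 8 * (C * J * k ^ 3 / L) := by ring
    rw [e] at hjos
    exact hjos
  have h8 : 0 < 8 * J * k ^ 2 := by positivity
  have h2 : 2 * k ^ 2 * (d2 / L ^ 4) - C * k / L ≤ E / (8 * J * k ^ 2) := by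
    rw [le_div_iff₀ h8]
    have e : (2 * k ^ 2 * (d2 / L ^ 4) - C * k / L) * (8 * J * k ^ 2) =
        16 * J * k ^ 4 * (d2 / L ^ 4) - 8 * (C * J * k ^ 3 / L) := by ring
    rw [e]
    exact hjos'
  -- the refinement inequality in density units
  have h1 : (2 * k) ^ 2 / L ^ 4 * c2 ≤ k ^ 2 / L ^ 4 * cK + 2 * k ^ 2 * (d2 / L ^ 4) := by
    have hkL : 0 ≤ k ^ 2 / L ^ 4 := by positivity
    have h3 : k ^ 2 / L ^ 4 * (4 * c2) ≤ k ^ 2 / L ^ 4 * (cK + 2 * d2) :=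
      mul_le_mul_of_nonneg_left (by linarith) hkL
    have e3 : (2 * k) ^ 2 / L ^ 4 * c2 = k ^ 2 / L ^ 4 * (4 * c2) := by ring
    have e4 : k ^ 2 / L ^ 4 * (cK + 2 * d2) = k ^ 2 / L ^ 4 * cK + 2 * k ^ 2 * (d2 / L ^ 4) := by
      ring
    rw [e3]
    rw [e4] at h3
    exact h3
  linarith

/-- Bookkeeping of the induction step, over plain reals (`t = 2^m`, cell counts `4t ↦ 8t`):
`E/(96J)(1 − 1/t²) + E/(8J(4t)²) = E/(96J)(1 − 1/(2t)²)` and `C(4t − 4)/L + C·4t/L = C(8t − 4)/L`.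
[folklore] -/
theorem chain_step_arith {ρK ρK' ρ4 E J C L t : ℝ}
    (hih : ρK ≤ ρ4 + (E / (96 * J) - E / (96 * J * t ^ 2)) + C * (4 * t - 4) / L)
    (hstep : ρK' ≤ ρK + E / (8 * J * (4 * t) ^ 2) + C * (4 * t) / L) :
    ρK' ≤ ρ4 + (E / (96 * J) - E / (96 * J * (2 * t) ^ 2)) + C * (4 * (2 * t) - 4) / L := by
  have e1 : C * (4 * (2 * t) - 4) / L = C * (4 * t - 4) / L + C * (4 * t) / L := by ring
  have e2 : E / (96 * J) - E / (96 * J * (2 * t) ^ 2) =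
      (E / (96 * J) - E / (96 * J * t ^ 2)) + E / (8 * J * (4 * t) ^ 2) := by ring
  rw [e1, e2]
  linarith

/-- Dropping the corrections of the sharp invariant: for `E, C ≥ 0` and `J, L > 0`,
`ρ_4 + E/(96J)(1 − 1/t²) + C(4t − 4)/L ≤ ρ_4 + E/(96J) + C·4t/L`. [folklore] -/
theorem chain_final_arith {ρ ρ4 E J C L t Kr : ℝ} (hJ : 0 < J) (hE : 0 ≤ E) (hC : 0 ≤ C)
    (hL : 0 < L) (hK : Kr = 4 * t)
    (h : ρ ≤ ρ4 + (E / (96 * J) - E / (96 * J * t ^ 2)) + C * (4 * t - 4) / L) :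
    ρ ≤ ρ4 + E / (96 * J) + C * Kr / L := by
  subst hK
  have h1 : 0 ≤ E / (96 * J * t ^ 2) := by positivity
  have h2 : C * (4 * t - 4) / L = C * (4 * t) / L - 4 * C / L := by ring
  have h3 : 0 ≤ 4 * C / L := by positivity
  rw [h2] at h
  linarith

/-! ### One dyadic step and the chain, in expectation form -/

/-- Transport of the cell coherence operator along equal cell counts (the `NeZero` instances are
propositions, hence agree). [folklore] -/
theorem cellCoherence_congr (L : ℕ) [NeZero L] {a b : ℕ} [NeZero a] [NeZero b] (h : a = b) :
    cellCoherence L a = cellCoherence L b := by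
  subst h
  rfl

/-- **One dyadic step** `k ↦ K = 2k` in density units: under Josephson at `K` with budget `E`,
`(K²/L⁴) Re⟨𝒞_K⟩ ≤ (k²/L⁴) Re⟨𝒞_k⟩ + E/(8 J k²) + C k/L` (refinement inequality
`4 Re⟨𝒞_{2k}⟩ − 2 Re⟨𝒟_{2k}⟩ ≤ Re⟨𝒞_k⟩` and `((2k)²/(2L⁴)) Re⟨𝒟_{2k}⟩ ≤ E/(8Jk²) + Ck/L`). [folklore] -/
theorem density_step (L : ℕ) [NeZero L] (k K : ℕ) [NeZero k] [NeZero K] (hK : K = 2 * k)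
    {J C E : ℝ} (φ : Fock (Orb (FermionTorus 2 L))) (hJ : 0 < J)
    (hJos : J * ((K : ℝ) / (L : ℝ)) ^ 4 * (expect (cellDirichlet L K) φ).re -
        C * J * (K : ℝ) ^ 3 / (L : ℝ) ≤ E) :
    (K : ℝ) ^ 2 / (L : ℝ) ^ 4 * (expect (cellCoherence L K) φ).re ≤
      (k : ℝ) ^ 2 / (L : ℝ) ^ 4 * (expect (cellCoherence L k) φ).re + E / (8 * J * (k : ℝ) ^ 2) +
        C * (k : ℝ) / (L : ℝ) := by
  subst hK
  have href := re_expect_cellCoherence_ge L k φ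
  have hk : (0 : ℝ) < k := Nat.cast_pos.mpr (Nat.pos_of_ne_zero (NeZero.ne k))
  push_cast at hJos ⊢
  exact step_arith hk hJ href hJos

/-- **The chain with its sharp invariant**: under the scale-wise Josephson hypothesis at `φ`,
for every `m` with `4·2^m·ℓ₁ ≤ L`,
`ρ_{4·2^m} ≤ ρ_4 + (E/(96J) − E/(96 J (2^m)²)) + C (4·2^m − 4)/L`
(induction on `m` along `density_step`, all scales `4·2^j`, `j ≤ m`, being admissible). [folklore] -/
theorem chain_aux (L : ℕ) [NeZero L] {J C E : ℝ} {ℓ₁ : ℕ} (φ : Fock (Orb (FermionTorus 2 L)))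
    (hJ : 0 < J)
    (hJos : ∀ (k : ℕ) [NeZero k], 4 ≤ k → k * ℓ₁ ≤ L →
      J * ((k : ℝ) / (L : ℝ)) ^ 4 * (expect (cellDirichlet L k) φ).re - C * J * (k : ℝ) ^ 3 / (L : ℝ) ≤ E) :
    ∀ m : ℕ, 4 * 2 ^ m * ℓ₁ ≤ L →
      ((4 * 2 ^ m : ℕ) : ℝ) ^ 2 / (L : ℝ) ^ 4 * (expect (cellCoherence L (4 * 2 ^ m)) φ).re ≤
        (4 : ℝ) ^ 2 / (L : ℝ) ^ 4 * (expect (cellCoherence L 4) φ).re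
          + (E / (96 * J) - E / (96 * J * ((2 : ℝ) ^ m) ^ 2)) + C * (4 * (2 : ℝ) ^ m - 4) / (L : ℝ) := by
  intro m
  induction m with
  | zero =>
    intro _
    rw [cellCoherence_congr L (show 4 * 2 ^ 0 = 4 by norm_num)]
    norm_num
  | succ m ih =>
    intro hm
    -- all smaller scales remain admissible
    have hmono : 4 * 2 ^ m * ℓ₁ ≤ 4 * 2 ^ (m + 1) * ℓ₁ :=
      Nat.mul_le_mul_right _ (Nat.mul_le_mul_left _ (Nat.pow_le_pow_right two_pos (Nat.le_succ m)))
    have hih := ih (le_trans hmono hm)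
    -- one dyadic step from `4·2^m` to `4·2^(m+1) = 2·(4·2^m)`
    have h4 : 4 ≤ 4 * 2 ^ (m + 1) := Nat.le_mul_of_pos_right _ (Nat.two_pow_pos _)
    have hstep := density_step L (4 * 2 ^ m) (4 * 2 ^ (m + 1)) (by ring) φ hJ
      (hJos (4 * 2 ^ (m + 1)) h4 hm)
    -- casts: everything is polynomial in `t = 2^m`
    have hc1 : ((4 * 2 ^ m : ℕ) : ℝ) = 4 * (2 : ℝ) ^ m := by push_cast; ring
    have hc2 : ((4 * 2 ^ (m + 1) : ℕ) : ℝ) = 2 * (4 * (2 : ℝ) ^ m) := by push_cast; ring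
    have h2 : (2 : ℝ) ^ (m + 1) = 2 * 2 ^ m := by ring
    rw [hc1] at hih hstep
    rw [hc2] at hstep ⊢
    rw [h2]
    exact chain_step_arith hih hstep

/-! ### The stub -/

/-- **Stub `stub_chain` of the line `Sketch`** (the dyadic telescope `4 → 8 → ⋯ → 4·2^m` at a fixed
side `L` and vector `φ`): under the scale-wise Josephson hypothesis at `φ` (rate `J > 0`, slack
constant `C ≥ 0`, bottom scale `ℓ₁`, energy budget `E ≥ 0`), in density units
`ρ_k = (k²/L⁴) Re⟨φ, 𝒞_k φ⟩`,
`ρ_{4·2^m} ≤ ρ_4 + E/(96 J) + C·(4·2^m)/L` whenever `4·2^m·ℓ₁ ≤ L`.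
Proof: `chain_aux` (refinement inequality `re_expect_cellCoherence_ge` iterated, with
`Σ_{j<m} E/(8J(4·2^j)²) = (E/(96J))(1 − 4^{-m}) ≤ E/(96J)` and `Σ_{j<m} C·4·2^j/L = C(4·2^m − 4)/L ≤ C·4·2^m/L`),
then `chain_final_arith`. [folklore] -/
theorem stub_chain :
    ∀ (L : ℕ) [NeZero L] (J C E : ℝ) (ℓ₁ : ℕ) (φ : Fock (Orb (FermionTorus 2 L))), 0 < J → 0 ≤ C → 0 ≤ E →
      (∀ (k : ℕ) [NeZero k], 4 ≤ k → k * ℓ₁ ≤ L →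
        J * ((k : ℝ) / (L : ℝ)) ^ 4 * (expect (cellDirichlet L k) φ).re - C * J * (k : ℝ) ^ 3 / (L : ℝ) ≤ E) →
      ∀ m : ℕ, 4 * 2 ^ m * ℓ₁ ≤ L →
        ((4 * 2 ^ m : ℕ) : ℝ) ^ 2 / (L : ℝ) ^ 4 * (expect (cellCoherence L (4 * 2 ^ m)) φ).re ≤
          (4 : ℝ) ^ 2 / (L : ℝ) ^ 4 * (expect (cellCoherence L 4) φ).re + E / (96 * J) +
            C * ((4 * 2 ^ m : ℕ) : ℝ) / (L : ℝ) := by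
  intro L _ J C E ℓ₁ φ hJ hC hE hJos m hm
  have hL : (0 : ℝ) < L := Nat.cast_pos.mpr (Nat.pos_of_ne_zero (NeZero.ne L))
  have hc : ((4 * 2 ^ m : ℕ) : ℝ) = 4 * (2 : ℝ) ^ m := by push_cast; ring
  exact chain_final_arith hJ hE hC hL hc (chain_aux L φ hJ hJos m hm)

end Summit.HubbardSuperconductivity.HubbardSuperconductivity.Theorems.LowEnergyRigidity.Telescope
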